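import Literature.Geometry.Riemannian.HopfRinowHeineBorel
import Literature.Geometry.Riemannian.CutLocusProofs
import HarnessLib

/-!
# Bounded sets and far balls in the ends of a complete Riemannian manifold
(Carron 2007, §2.1.1 and Lemma 2.7)

Third layer (geometry) of the proof programme of
`Literature.Geometry.Riemannian.Carron1998_ends_le_rank_l2HarmonicOneForms`
(`L2HarmonicOneFormsSobolev.lean`), where completeness enters exactly as in G. Carron, *L²
harmonic forms on non-compact Riemannian manifolds*, arXiv:0704.3194 (2007), §2.1.1: "When `g`
is complete Riemannian metric on `M`, then `U ⊂ M` is bounded if and only if there is some `R > 0`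
and `o ∈ M` such that `U ⊂ B(o, R)`" — the Heine–Borel property of complete Riemannian manifolds,
which is the tree's `isCompact_setOf_edist_le` (`HopfRinowHeineBorel.lean`, O'Neill 1983, Ch. 5,
Thm. 21, (C) ⇒ (HB)). For a smooth Riemannian metric `g` (any real model with corners, `∞ ≤ n`)
with geodesically complete Levi-Civita connection on a connected Hausdorff manifold without
boundary, we PROVE

* `isCompact_closure_of_forall_edist_le`, `exists_mem_lt_edist_of_not_isCompact_closure` —
  bounded sets have compact closure; a set with non-compact closure has points at arbitrarily
  large distance from any base point (Carron's "bounded iff inside some `B(o, R)`");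
* `setOf_edist_lt_subset_connectedComponentIn` — an open distance ball contained in a set `F`
  lies in one connected component of `F` (it is swept by the minimizing segments from its centre,
  `exists_isMinimizingUpTo_of_isGeodesicallyComplete` and `edist_maximalGeodesic_le_length`);
* `exists_setOf_edist_lt_subset_diff` — **far balls in an end**: if `C` is the connected
  component in `X ∖ K` of each of its points (`K` compact) and `C ∖ W` has non-compact closure
  for a compact `W ⊇ K`, then for every radius `r` some ball `B(x, r)` lies in `C ∖ W` (the
  geometric input of Carron's Lemma 2.7: "the open geodesic balls `B(γ(R + (2l+1)ε), ε)` are in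
  `U`").

Everything is proved; no definitions, no named facts (D-0026).

## References

* G. Carron, *L² harmonic forms on non-compact Riemannian manifolds*, arXiv:0704.3194 (2007),
  §2.1.1 and Lemma 2.7. [`Carron2007`]
* B. O'Neill, *Semi-Riemannian geometry*, Academic Press 1983, Ch. 5, Thm. 21 (Hopf–Rinow),
  Def. 15, Prop. 18. [`ONeill1983`]
* J. M. Lee, *Introduction to Riemannian Manifolds*, 2nd ed., GTM 176 (2018), Thm. 6.19
  (Hopf–Rinow), Cor. 6.21. [`LeeRiemannianManifolds2018`]
-/

noncomputable section

open Bundle Set Function Filter Topology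
open scoped Manifold ContDiff ENNReal NNReal

namespace Literature.Geometry.Riemannian

open Literature.Geometry.Lorentzian
open Literature.Geometry.Lorentzian.PseudoRiemannianMetric

variable {E : Type*} [NormedAddCommGroup E] [NormedSpace ℝ E] {H : Type*} [TopologicalSpace H]
  {I : ModelWithCorners ℝ E H} {M : Type*} [TopologicalSpace M] [ChartedSpace H M]
  [IsManifold I ∞ M] {n : ℕ∞ω} [FiniteDimensional ℝ E] [CompleteSpace E] [T2Space M]
  [ConnectedSpace M] [BoundarylessManifold I M]
  (g : PseudoRiemannianMetric I n E (TangentSpace I : M → Type _)) [g.HasLeviCivita]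
  [CovariantDerivative.ContMDiffCovariantDerivative g.leviCivita 1]

/-! ### Bounded sets -/

/-- **Bounded sets are relatively compact** on a complete Riemannian manifold (Carron 2007,
§2.1.1: "`U ⊂ M` is bounded if and only if … `U ⊂ B(o, R)`"; O'Neill 1983, Ch. 5, Thm. 21 (HB);
the tree's `isCompact_setOf_edist_le`). [cite: Carron2007, §2.1.1] -/
theorem isCompact_closure_of_forall_edist_le (hn : (∞ : ℕ∞ω) ≤ n) (hg : g.IsRiemannian)
    (hc : IsGeodesicallyComplete g.leviCivita) (p : M) {R : ℝ} {S : Set M}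
    (hS : ∀ q ∈ S, g.edist hg p q ≤ ENNReal.ofReal R) : IsCompact (closure S) := by
  haveI : LocallyCompactSpace M := Manifold.locallyCompact_of_finiteDimensional I
  haveI : RegularSpace M := inferInstance
  have hcl : IsClosed {q : M | g.edist hg p q ≤ ENNReal.ofReal R} :=
    isClosed_le ((continuous_edist hg).comp (continuous_const.prodMk continuous_id))
      continuous_const
  have key : IsCompact {q : M | g.edist hg p q ≤ ENNReal.ofReal R} :=
    isCompact_setOf_edist_le g hn hg hc p R.toNNReal
  exact key.of_isClosed_subset isClosed_closure (closure_minimal (fun q hq ↦ hS q hq) hcl)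

/-- **Unbounded sets reach arbitrarily far**: if `closure S` is not compact then for every `R`
some point of `S` is at distance `> R` from `p`. [cite: Carron2007, §2.1.1] -/
theorem exists_mem_lt_edist_of_not_isCompact_closure (hn : (∞ : ℕ∞ω) ≤ n) (hg : g.IsRiemannian)
    (hc : IsGeodesicallyComplete g.leviCivita) (p : M) {S : Set M}
    (hS : ¬ IsCompact (closure S)) (R : ℝ) : ∃ q ∈ S, ENNReal.ofReal R < g.edist hg p q := by
  by_contra h
  simp only [not_exists, not_and, not_lt] at h
  exact hS (isCompact_closure_of_forall_edist_le g hn hg hc p (R := R) fun q hq ↦ h q hq)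

/-! ### Balls and connected components -/

/-- **An open distance ball inside `F` lies in a single component of `F`**: every `q` with
`d(x, q) < r` is the endpoint of a minimizing segment `γ_v|[0,1]` from `x`
(`exists_isMinimizingUpTo_of_isGeodesicallyComplete`), all of whose points satisfy
`d(x, γ_v(t)) ≤ t |v| ≤ d(x, q) < r`; the segment is connected, so `q ∈ connectedComponentIn F x`.
(Carron 2007, proof of Lemma 2.7: the balls centred on a minimizing geodesic inside `U` "are in
`U`".) [cite: Carron2007, Lemma 2.7] -/
theorem setOf_edist_lt_subset_connectedComponentIn (hn : (∞ : ℕ∞ω) ≤ n) (hg : g.IsRiemannian)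
    (hc : IsGeodesicallyComplete g.leviCivita) (x : M) {r : ℝ≥0∞} {F : Set M}
    (hF : {q : M | g.edist hg x q < r} ⊆ F) :
    {q : M | g.edist hg x q < r} ⊆ connectedComponentIn F x := by
  haveI : Fact (1 ≤ n) := ⟨le_trans (by exact_mod_cast le_top) hn⟩
  intro q hq
  obtain ⟨v, hmin, hvq⟩ := exists_isMinimizingUpTo_of_isGeodesicallyComplete g hn hg hc x q
  obtain ⟨-, hgeo, hγ0, -⟩ := maximalGeodesic_of_isGeodesicallyComplete hc x v
  have hγ1 : maximalGeodesic g.leviCivita x v 1 = q := by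
    rw [← expMap_eq_maximalGeodesic hc x v]; exact hvq
  -- `d(x, q) = |v|`
  have hlen := hmin.2
  rw [length_maximalGeodesic hg hc x v 0 1, sub_zero, one_mul] at hlen
  have hdq : g.edist hg x q = ENNReal.ofReal (Real.sqrt (g.val x v v)) := by
    rw [← hγ1]; exact hlen.symm
  -- the points of the segment stay in the ball
  have hseg : ∀ t ∈ Icc (0 : ℝ) 1, g.edist hg x (maximalGeodesic g.leviCivita x v t) < r := by
    intro t ht
    have h1 : g.edist hg (maximalGeodesic g.leviCivita x v 0) (maximalGeodesic g.leviCivita x v t) ≤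
        g.length hg (maximalGeodesic g.leviCivita x v) 0 t :=
      edist_maximalGeodesic_le_length hg hc x v ht.1
    rw [hγ0, length_maximalGeodesic hg hc x v 0 t, sub_zero] at h1
    calc g.edist hg x (maximalGeodesic g.leviCivita x v t)
        ≤ ENNReal.ofReal (t * Real.sqrt (g.val x v v)) := h1
      _ ≤ ENNReal.ofReal (Real.sqrt (g.val x v v)) := by
          refine ENNReal.ofReal_le_ofReal ?_
          calc t * Real.sqrt (g.val x v v) ≤ 1 * Real.sqrt (g.val x v v) :=
                mul_le_mul_of_nonneg_right ht.2 (Real.sqrt_nonneg _)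
            _ = Real.sqrt (g.val x v v) := one_mul _
      _ = g.edist hg x q := hdq.symm
      _ < r := hq
  -- the segment is connected and joins `x` to `q` inside `F`
  have hcont : ContinuousOn (maximalGeodesic g.leviCivita x v) (Icc 0 1) :=
    hgeo.continuous.continuousOn
  have hpre : IsPreconnected (maximalGeodesic g.leviCivita x v '' Icc 0 1) :=
    isPreconnected_Icc.image _ hcont
  have hxmem : x ∈ maximalGeodesic g.leviCivita x v '' Icc 0 1 := ⟨0, ⟨le_rfl, zero_le_one⟩, hγ0⟩
  have hsubF : maximalGeodesic g.leviCivita x v '' Icc 0 1 ⊆ F := by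
    rintro _ ⟨t, ht, rfl⟩
    exact hF (hseg t ht)
  have hqmem : q ∈ maximalGeodesic g.leviCivita x v '' Icc 0 1 := ⟨1, ⟨zero_le_one, le_rfl⟩, hγ1⟩
  exact hpre.subset_connectedComponentIn hxmem hsubF hqmem

/-! ### Far balls in an end -/

/-- **Far balls in an end** (the geometric input of Carron 2007, Lemma 2.7: for an unbounded
component `U` of `M ∖ K` and a compact set, geodesic balls of any radius centred far out in `U`
lie in `U` and avoid the compact set). Let `K` be compact, `W ⊇ K` compact, and `C ⊆ X ∖ K` a
set which is the connected component in `X ∖ K` of each of its points (so `C ⊆ X ∖ K`), such that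
`C ∖ W` has non-compact closure. Then for every `r` there is `x ∈ C ∖ W` with `B(x, r) ⊆ C ∖ W`: pick
`x ∈ C ∖ W` with `d(p, x) > R₀ + r`, where `B̄(p, R₀) ⊇ W` (`W` is compact, `d(p, ·)` continuous
and finite); then `B(x, r)` misses `W ⊇ K` by the triangle inequality and lies in the component
`C` of `x` (`setOf_edist_lt_subset_connectedComponentIn`). [cite: Carron2007, Lemma 2.7] -/
theorem exists_setOf_edist_lt_subset_diff (hn : (∞ : ℕ∞ω) ≤ n) (hg : g.IsRiemannian)
    (hc : IsGeodesicallyComplete g.leviCivita) {K W C : Set M} (hW : IsCompact W) (hKW : K ⊆ W)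
    (hC : ∀ x ∈ C, connectedComponentIn Kᶜ x = C)
    (hfar : ¬ IsCompact (closure (C \ W))) (r : ℝ) :
    ∃ x ∈ C \ W, {q : M | g.edist hg x q < ENNReal.ofReal r} ⊆ C \ W := by
  classical
  haveI : LocallyCompactSpace M := Manifold.locallyCompact_of_finiteDimensional I
  haveI : RegularSpace M := inferInstance
  rcases isEmpty_or_nonempty M with hM | ⟨⟨p⟩⟩
  · exact absurd (by rw [Set.eq_empty_of_isEmpty (closure (C \ W))]; exact isCompact_empty) hfar
  -- `W ⊆ B̄(p, R₀)` with `R₀` real: `d(p, ·)` is finite and continuous on the compact `W`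
  have hfin : ∀ q, g.edist hg p q ≠ ⊤ := fun q ↦ edist_ne_top hg p q
  set D : M → ℝ := fun q ↦ (g.edist hg p q).toReal with hD
  have hDc : Continuous D := ENNReal.continuousOn_toReal.comp_continuous
    ((continuous_edist hg).comp (continuous_const.prodMk continuous_id)) fun q ↦ hfin q
  obtain ⟨R₀, hR₀⟩ : ∃ R₀ : ℝ, ∀ q ∈ W, D q ≤ R₀ := by
    rcases W.eq_empty_or_nonempty with hWe | hWne
    · exact ⟨0, by simp [hWe]⟩
    · obtain ⟨q₀, -, hq₀⟩ := hW.exists_isMaxOn hWne hDc.continuousOn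
      exact ⟨D q₀, fun q hq ↦ hq₀ hq⟩
  -- a far point `x ∈ C ∖ W`
  obtain ⟨x, hx, hfarx⟩ :=
    exists_mem_lt_edist_of_not_isCompact_closure g hn hg hc p hfar (max R₀ 0 + max r 0)
  refine ⟨x, hx, fun q hq ↦ ?_⟩
  -- `d(p, q) > R₀`, so `q ∉ W`
  have hqW : q ∉ W := by
    intro hqW
    have h1 : g.edist hg p x ≤ g.edist hg p q + g.edist hg q x := edist_triangle hg p q x
    have h2 : g.edist hg q x = g.edist hg x q := edist_comm hg q x
    have h3 : g.edist hg p q ≤ ENNReal.ofReal (max R₀ 0) := by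
      rw [← ENNReal.ofReal_toReal (hfin q)]
      exact ENNReal.ofReal_le_ofReal ((hR₀ q hqW).trans (le_max_left _ _))
    have h4 : g.edist hg x q < ENNReal.ofReal (max r 0) :=
      hq.trans_le (ENNReal.ofReal_le_ofReal (le_max_left _ _))
    have h5 : g.edist hg p x < ENNReal.ofReal (max R₀ 0) + ENNReal.ofReal (max r 0) :=
      calc g.edist hg p x ≤ g.edist hg p q + g.edist hg q x := h1
        _ < ENNReal.ofReal (max R₀ 0) + ENNReal.ofReal (max r 0) := by
            rw [h2]
            exact ENNReal.add_lt_add_of_le_of_lt (hfin q) h3 h4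
    rw [← ENNReal.ofReal_add (le_max_right _ _) (le_max_right _ _)] at h5
    exact lt_irrefl _ (hfarx.trans h5)
  -- the ball lies in `Kᶜ`, hence in the component `C` of `x`
  have hball : {q : M | g.edist hg x q < ENNReal.ofReal r} ⊆ Kᶜ := by
    intro q' hq' hq'K
    -- the same computation for `q'`
    have h1 : g.edist hg p x ≤ g.edist hg p q' + g.edist hg q' x := edist_triangle hg p q' x
    have h2 : g.edist hg q' x = g.edist hg x q' := edist_comm hg q' x
    have h3 : g.edist hg p q' ≤ ENNReal.ofReal (max R₀ 0) := by
      rw [← ENNReal.ofReal_toReal (hfin q')]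
      exact ENNReal.ofReal_le_ofReal ((hR₀ q' (hKW hq'K)).trans (le_max_left _ _))
    have h4 : g.edist hg x q' < ENNReal.ofReal (max r 0) :=
      hq'.trans_le (ENNReal.ofReal_le_ofReal (le_max_left _ _))
    have h5 : g.edist hg p x < ENNReal.ofReal (max R₀ 0) + ENNReal.ofReal (max r 0) :=
      calc g.edist hg p x ≤ g.edist hg p q' + g.edist hg q' x := h1
        _ < ENNReal.ofReal (max R₀ 0) + ENNReal.ofReal (max r 0) := by
            rw [h2]
            exact ENNReal.add_lt_add_of_le_of_lt (hfin q') h3 h4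
    rw [← ENNReal.ofReal_add (le_max_right _ _) (le_max_right _ _)] at h5
    exact lt_irrefl _ (hfarx.trans h5)
  have hcomp := setOf_edist_lt_subset_connectedComponentIn g hn hg hc x hball
  rw [hC x hx.1] at hcomp
  exact ⟨hcomp hq, hqW⟩

end Literature.Geometry.Riemannian

end
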